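import Summits.AtomisticToContinuum.Crystallization.Theorems.FrustratedLawDichotomySignedLedgerErgodic

/-!
(SPLIT FOR THE 400-LINE CAP by the landing lane, hand-2 g45: this file = part A; part B = `…FrustratedLawDichotomySingleGrainTube` imports it; same namespace, all FQNs unchanged.)
# FrustratedLawDichotomy · crux `AperiodicFrustratedLawGap` (stmt-AtomisticToContinuum-27623) — THE SINGLE-GRAIN CELL (MEAN-HOST ENGINE)
# (decomp-a2c, RESIDUAL lens-5 «finite/base range + asymptotic regime + bridge», generation 110; T-side, branch E′, ORDER (1) of critic r1688 (B))

The `p = 0` (no core, one grain) corner of the E′ ledger; lens dial = the WINDOW RADIUS `ρ` (tube radius `τ`, `ρ = 2τ`).  A single-grain configuration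
is `cfg L u = count|{L n + (u n − u 0) : n ∈ ℤ³}` (host homomorphism `L : ℤ³ →+ ℝ³`, displacement field `u`); through the labels, point-stationarity of
its law is `ℤ³`-SHIFT-STATIONARITY of the law `Q` of `u` (re-rooting at the atom labelled `m` = shift by `m`; typed bridge `LabellingTransfer`).
PROVED (0 sorry): §1 THE FIRST ORDER DIES IN THE MEAN — (a) on a `τ`-tube `E_Q[u n − u 0] = 0` (telescoping `N·E[u n − u 0] = E[u (N•n) − u 0]`, norm
`≤ 2τ`); (b) for ANY shift-stationary law the mean increments are ADDITIVE in the label (`integral_eval_sub_eval_add`): they form the law's MEAN HOST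
`ℤ³ →+ ℝ³`, about which every mean increment vanishes by definition — so the engine needs only SMALL WINDOW INCREMENTS (`IsWindow B ρ`: drifting
strain allowed), not a global tube; this REPLACES the signed first-variation transport (`…SignedLedger.LawLedger`, fields `F`/`G`) in this cell;
§2 per-bond second-order floors over a finite bond window, integrated: `E_Q[windowEnergy] ≥ windowEnergy(host) − Θ` given mean host `L` on the window
and a MEAN second-order floor `−Θ` (`MeanSecondOrderFloor` = THE BRIDGE PIECE of the dial); §3 its two instances — FINITE RANGE (`Θ = ¼ρ²Σλ`,
pointwise Hessian floors, no phonon analysis) and ASYMPTOTIC REGIME (`Θ = ¼ρ³Σκ` from the typed `MeanHarmonicStability` + cubic slack); §4 law level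
— `cfg`, `isRootedHardCore_cfg`, the MEAN-HOST GLUE `lt_integral_rootEnergy_of_meanHost`, the tube targets `SingleGrainGapQ` / `SingleGrainGap`
(currency `e⋆ < E_P[rootEnergy V_LJ]`), tube glue, finite-range corollary, dial lemma; §5 the SOCKET to the E′ assembly of record
(`…SignedLedgerErgodic` #49 by name): a mean gap IS a `LawLedger` with zero transport ⇒ `nonempty_lawLedger_of_singleGrainGap`.
TYPED, not proved: `LabellingTransfer` [bookkeeping·ATTACKABLE-M·HevelingLast2005], `WindowTransfer` [bookkeeping·ATTACKABLE-S·tree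
`…TransportPriceTail.abs_rootEnergy_sub_truncated_le`], the per-host certificate rows and margin [INSTRUMENTABLE·E-side γ_L], `MeanHarmonicStability`
[UNDECIDED per strained host·INSTRUMENTABLE; cf. crux `PhononStability` stmt-9333].
HONEST SCOPE (TOY RUNG): the texture clauses of 27623 force 1/8-bad sites near almost every atom, so single-grain laws are NOT admissible laws of the
crux — this is the SECOND-ORDER ENGINE of E′, not a split piece; in a finite grain the first order leaves a BOUNDARY load `≤ ½ρ·|φ′(‖L n‖)|` per
boundary bond, which ORDER (2) (dense cell + hole credit) must price against the core surplus `σ_bad` (node memo NODE-g110.md).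
Tags: §1–§3 [folklore: stationary increments have additive means / bounded cocycles have zero drift; Taylor floors]; §4–§5 [new: bookkeeping only].
No instances, no notation.
-/

noncomputable section

namespace Summit.AtomisticToContinuum.Crystallization.Theorems.FrustratedLawDichotomySingleGrainTube

open MeasureTheory Metric Set Filter
open scoped ENNReal Topology BigOperators
open Literature.MathematicalPhysics.StatisticalMechanics Literature.Probability.Process
open Summit.AtomisticToContinuum.Crystallization.Theorems.ChargedEnergyGapNegative (E3 eStar)
open Summit.AtomisticToContinuum.Crystallization.Theorems.FrustratedLawDichotomySignedLedger (LawLedger net)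
open Summit.AtomisticToContinuum.Crystallization.Theorems.FrustratedLawDichotomySignedLedgerErgodic (nonempty_lawLedger_of_integrableFloor)
open Summit.AtomisticToContinuum.Crystallization.Theorems.FrustratedLawDichotomyFiniteClusterGap (integrable_rootEnergy_of_ae_hardCore)

/-! ## §0. Labelled displacement fields on the host lattice `ℤ³` -/

/-- Labels: the abstract host lattice `ℤ³`. -/ abbrev Idx : Type := Fin 3 → ℤ

/-- The lattice SHIFT of a displacement field: `shift m u n = u (n + m)` (the field seen from the atom labelled `m`). -/
def shift (m : Idx) (u : Idx → E3) : Idx → E3 := fun n => u (n + m)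

/-- The shift by `m` as a measurable equivalence (inverse: the shift by `-m`; shifts are measurable for the product σ-algebra). -/
def shiftEquiv (m : Idx) : (Idx → E3) ≃ᵐ (Idx → E3) where
  toFun := shift m
  invFun := shift (-m)
  left_inv u := by funext n; simp [shift]
  right_inv u := by funext n; simp [shift]
  measurable_toFun := measurable_pi_lambda _ fun n => measurable_pi_apply (n + m)
  measurable_invFun := measurable_pi_lambda _ fun n => measurable_pi_apply (n + -m)

/-- `ℤ³`-SHIFT-STATIONARITY of a law `Q` of displacement fields: every shift preserves `Q` (through the labels: point-stationarity of the law of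
the configuration — re-rooting at the atom labelled `m` is the shift by `m`; see `LabellingTransfer`). -/
def IsShiftStationary (Q : Measure (Idx → E3)) : Prop := ∀ m : Idx, MeasurePreserving (shift m) Q Q

/-- The `τ`-TUBE: `Q`-almost surely every displacement has norm `≤ τ`. -/
def IsTube (τ : ℝ) (Q : Measure (Idx → E3)) : Prop := ∀ᵐ u ∂Q, ∀ n, ‖u n‖ ≤ τ

/-- The tube condition is monotone in the radius (the dial). -/
theorem IsTube.mono {τ τ' : ℝ} {Q : Measure (Idx → E3)} (h : IsTube τ' Q) (hτ : τ' ≤ τ) : IsTube τ Q := by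
  filter_upwards [h] with u hu n using (hu n).trans hτ

variable {Q : Measure (Idx → E3)} {τ : ℝ}

/-- On a tube law every increment `u n − u m` is integrable (bounded by `2τ`, measurable). -/
theorem integrable_eval_sub_eval [IsFiniteMeasure Q] (hτ : IsTube τ Q) (n m : Idx) :
    Integrable (fun u : Idx → E3 => u n - u m) Q := by
  refine Integrable.of_bound ((measurable_pi_apply n).sub (measurable_pi_apply m)).aestronglyMeasurable (τ + τ) ?_
  filter_upwards [hτ] with u hu using (norm_sub_le _ _).trans (add_le_add (hu n) (hu m))

/-- Change of root = change of variables: under a shift-stationary law, `E_Q[g ∘ shift m] = E_Q[g]`. -/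
theorem integral_comp_shift {F : Type*} [NormedAddCommGroup F] [NormedSpace ℝ F] (hstat : IsShiftStationary Q) (m : Idx) (g : (Idx → E3) → F) :
    ∫ u, g (shift m u) ∂Q = ∫ u, g u ∂Q :=
  (hstat m).integral_comp (shiftEquiv m).measurableEmbedding g

/-! ## §1. The first order dies in the mean -/

/-- **THE FIRST ORDER DIES IN THE MEAN.**  For a shift-stationary `τ`-tube probability law `Q` and every label `n`, `E_Q[u n − u 0] = 0`
(`N • v = E_Q[u (N • n) − u 0]` by stationarity and telescoping, norm `≤ 2τ` for every `N`); hence every LINEAR functional of the increments —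
the first variation of the window energy — has mean zero: no transport kernel, no flux pricing. [folklore: bounded stationary cocycles have zero drift] -/
theorem integral_eval_sub_eval_zero_eq_zero (Q : Measure (Idx → E3)) [IsProbabilityMeasure Q] (hstat : IsShiftStationary Q)
    {τ : ℝ} (hτ : IsTube τ Q) (n : Idx) : ∫ u, (u n - u 0) ∂Q = 0 := by
  -- every lattice step along `n` has the same mean increment
  have hstep : ∀ k : ℕ, ∫ u, (u ((k + 1) • n) - u (k • n)) ∂Q = ∫ u, (u n - u 0) ∂Q := by
    intro k; simpa only [shift, zero_add, succ_nsmul'] using integral_comp_shift hstat (k • n) (fun u : Idx → E3 => u n - u 0)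
  -- telescoping: `N • v = E[u (N • n) − u 0]`
  have htel : ∀ N : ℕ, (N : ℝ) • ∫ u, (u n - u 0) ∂Q = ∫ u, (u (N • n) - u 0) ∂Q := by
    intro N
    have hint : ∀ k ∈ Finset.range N, Integrable (fun u : Idx → E3 => u ((k + 1) • n) - u (k • n)) Q :=
      fun k _ => integrable_eval_sub_eval hτ _ _
    calc (N : ℝ) • ∫ u, (u n - u 0) ∂Q = ∑ k ∈ Finset.range N, ∫ u, (u ((k + 1) • n) - u (k • n)) ∂Q := by
          rw [Finset.sum_congr rfl fun k _ => hstep k, Finset.sum_const, Finset.card_range, Nat.cast_smul_eq_nsmul]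
      _ = ∫ u, ∑ k ∈ Finset.range N, (u ((k + 1) • n) - u (k • n)) ∂Q := (integral_finsetSum _ hint).symm
      _ = ∫ u, (u (N • n) - u 0) ∂Q := by
          refine integral_congr_ae (ae_of_all _ fun u => ?_)
          simpa only [zero_nsmul] using Finset.sum_range_sub (fun k => u (k • n)) N
  -- the telescoped mean is bounded by `2τ`
  have hbd : ∀ N : ℕ, (N : ℝ) * ‖∫ u, (u n - u 0) ∂Q‖ ≤ τ + τ := by
    intro N
    have h1 : ‖∫ u, (u (N • n) - u 0) ∂Q‖ ≤ (τ + τ) * Q.real univ :=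
      norm_integral_le_of_norm_le_const (by filter_upwards [hτ] with u hu using (norm_sub_le _ _).trans (add_le_add (hu _) (hu _)))
    rwa [probReal_univ, mul_one, ← htel N, norm_smul, Real.norm_natCast] at h1
  by_contra hne  -- hence the mean increment vanishes
  obtain ⟨N, hN⟩ := exists_nat_gt ((τ + τ) / ‖∫ u, (u n - u 0) ∂Q‖)
  exact absurd (hbd N) (not_le.mpr ((div_lt_iff₀ (norm_pos_iff.mpr hne)).mp hN))

/-- **MEAN INCREMENTS ARE ADDITIVE.**  Under shift-stationarity (increments integrable) `E[u (n + m) − u 0] = E[u n − u 0] + E[u m − u 0]`: the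
mean increments of ANY shift-stationary labelled law form a homomorphism `ℤ³ →+ ℝ³` — the law's MEAN HOST — and re-expanding about it makes every
mean increment vanish BY DEFINITION (the tube theorem above is the statement «a `τ`-tube about `L` has mean host `L`»).  This is what lets the
engine below run on grains with slowly drifting strain: only the WINDOW increments need to be small. [folklore] -/
theorem integral_eval_sub_eval_add (hstat : IsShiftStationary Q) (hint : ∀ n m : Idx, Integrable (fun u : Idx → E3 => u n - u m) Q)
    (n m : Idx) : ∫ u, (u (n + m) - u 0) ∂Q = (∫ u, (u n - u 0) ∂Q) + ∫ u, (u m - u 0) ∂Q := by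
  have h := integral_comp_shift hstat m (fun u : Idx → E3 => u n - u 0)
  simp only [shift, zero_add] at h
  rw [← h, ← integral_add (hint _ _) (hint _ _)]
  exact integral_congr_ae (ae_of_all _ fun u => by abel)

/-! ## §2. Window energy, per-bond floors, and the mean floor (hypotheses: MEAN HOST on the window + SMALL WINDOW INCREMENTS) -/

/-- WINDOW ENERGY of the root of the labelled configuration over the finite bond window `B`: `½ Σ_{n ∈ B} φ(‖L n + (u n − u 0)‖)`
(the `n = 0` term is the constant `φ 0`, `= 0` for Lennard-Jones; at `u = 0` it is the host's window energy). -/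
def windowEnergy (φ : ℝ → ℝ) (L : Idx → E3) (B : Finset Idx) (u : Idx → E3) : ℝ :=
  (∑ n ∈ B, φ ‖L n + (u n - u 0)‖) / 2

/-- PER-BOND SECOND-ORDER FLOOR CERTIFICATE for the bond vector `x` at radius `ρ`: `φ(‖x‖) + ℓ D + q(D)/2 ≤ φ(‖x + D‖)` for `‖D‖ ≤ ρ`;
`ℓ` = the differential (only its linearity is used: it dies in the mean), `q` = ANY second-order term (crude `−λ‖D‖²`, λ = negative part of the
bond Hessian over the ball; harmonic `⟨H D, D⟩ − κ‖D‖³`). [INSTRUMENTABLE per host and shell: interval Taylor bounds for `V_LJ`] -/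
def BondFloor (φ : ℝ → ℝ) (x : E3) (ρ : ℝ) (ℓ : E3 →L[ℝ] ℝ) (q : E3 → ℝ) : Prop :=
  ∀ D : E3, ‖D‖ ≤ ρ → φ ‖x‖ + ℓ D + q D / 2 ≤ φ ‖x + D‖

/-- SMALL WINDOW INCREMENTS: `Q`-a.s. every window increment `u n − u 0`, `n ∈ B`, has norm `≤ ρ` (a LOCAL tube about the host; a global `τ`-tube
gives `ρ = 2τ`, `isWindow_of_isTube`). -/
def IsWindow (B : Finset Idx) (ρ : ℝ) (Q : Measure (Idx → E3)) : Prop := ∀ᵐ u ∂Q, ∀ n ∈ B, ‖u n - u 0‖ ≤ ρ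

variable {φ : ℝ → ℝ} {L : Idx → E3} {B : Finset Idx} {ρ : ℝ} {ℓ : Idx → E3 →L[ℝ] ℝ} {q : Idx → E3 → ℝ}

/-- On a `τ`-tube every window increment has norm `≤ 2τ`. -/
theorem norm_eval_sub_eval_zero_le {u : Idx → E3} (hu : ∀ n, ‖u n‖ ≤ τ) (n : Idx) : ‖u n - u 0‖ ≤ 2 * τ := by
  rw [two_mul]; exact (norm_sub_le _ _).trans (add_le_add (hu n) (hu 0))
/-- On a `τ`-tube every window `B` has increments of norm `≤ 2τ` almost surely (`IsWindow B (2τ)`). [folklore] -/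
theorem isWindow_of_isTube (B : Finset Idx) (hτ : IsTube τ Q) : IsWindow B (2 * τ) Q := by
  filter_upwards [hτ] with u hu n _ using norm_eval_sub_eval_zero_le hu n

/-- **Deterministic window floor.**  Summing the per-bond certificates over the window:
`windowEnergy(host) + ½ Σ ℓ_n(D_n) + ¼ Σ q_n(D_n) ≤ windowEnergy(u)` with `D_n = u n − u 0`, `‖D_n‖ ≤ ρ`. [folklore] -/
theorem windowEnergy_ge_pointwise (hcert : ∀ n ∈ B, BondFloor φ (L n) ρ (ℓ n) (q n)) {u : Idx → E3}
    (hu : ∀ n ∈ B, ‖u n - u 0‖ ≤ ρ) :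
    windowEnergy φ L B 0 + (∑ n ∈ B, ℓ n (u n - u 0)) / 2 + (∑ n ∈ B, q n (u n - u 0)) / 4 ≤ windowEnergy φ L B u := by
  have h0 : windowEnergy φ L B 0 = (∑ n ∈ B, φ ‖L n‖) / 2 := by simp [windowEnergy]
  rw [h0, windowEnergy]
  have hsum : ∑ n ∈ B, (φ ‖L n‖ + ℓ n (u n - u 0) + q n (u n - u 0) / 2) ≤ ∑ n ∈ B, φ ‖L n + (u n - u 0)‖ :=
    Finset.sum_le_sum fun n hn => hcert n hn _ (hu n hn)
  rw [Finset.sum_add_distrib, Finset.sum_add_distrib, ← Finset.sum_div] at hsum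
  linarith

/-- **THE BRIDGE PIECE of the dial: a MEAN SECOND-ORDER FLOOR at window radius `ρ`.**  On every shift-stationary probability law with window
increments `≤ ρ` the mean of `¼ Σ_{n ∈ B} q_n(u n − u 0)` is at least `−Θ` (instances: `meanSecondOrderFloor_of_pointwise`, `…_of_harmonic`). -/
def MeanSecondOrderFloor (B : Finset Idx) (q : Idx → E3 → ℝ) (ρ Θ : ℝ) : Prop :=
  ∀ Q : Measure (Idx → E3), IsProbabilityMeasure Q → IsShiftStationary Q → IsWindow B ρ Q → -Θ ≤ ∫ u, (∑ n ∈ B, q n (u n - u 0)) / 4 ∂Q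

/-- Window increments are integrable under the small-window hypothesis. -/
theorem integrable_eval_sub_eval_zero_of_isWindow [IsFiniteMeasure Q] (hwin : IsWindow B ρ Q) {n : Idx} (hn : n ∈ B) :
    Integrable (fun u : Idx → E3 => u n - u 0) Q := by
  refine Integrable.of_bound ((measurable_pi_apply n).sub (measurable_pi_apply 0)).aestronglyMeasurable ρ ?_
  filter_upwards [hwin] with u hu using hu n hn

/-- A finite sum of terms bounded on the window ball and measurable in the increment is integrable. -/
theorem integrable_finset_sum_of_isWindow [IsFiniteMeasure Q] (hwin : IsWindow B ρ Q) {g : Idx → E3 → ℝ} (hgm : ∀ n ∈ B, Measurable (g n))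
    {C : ℝ} (hgb : ∀ n ∈ B, ∀ D : E3, ‖D‖ ≤ ρ → |g n D| ≤ C) : Integrable (fun u : Idx → E3 => ∑ n ∈ B, g n (u n - u 0)) Q := by
  refine integrable_finsetSum _ fun n hn => ?_
  refine Integrable.of_bound ((hgm n hn).comp ((measurable_pi_apply n).sub (measurable_pi_apply 0))).aestronglyMeasurable C ?_
  filter_upwards [hwin] with u hu
  rw [Real.norm_eq_abs]; exact hgb n hn _ (hu n hn)

/-- The window energy is integrable when `φ` is measurable and the window terms are bounded on the window ball. -/
theorem integrable_windowEnergy [IsFiniteMeasure Q] (hwin : IsWindow B ρ Q) (hφm : Measurable φ) {C : ℝ}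
    (hφb : ∀ n ∈ B, ∀ D : E3, ‖D‖ ≤ ρ → |φ ‖L n + D‖| ≤ C) : Integrable (windowEnergy φ L B) Q := by
  exact (integrable_finset_sum_of_isWindow (B := B) hwin (g := fun n D => φ ‖L n + D‖)
    (fun n _ => hφm.comp (measurable_const.add measurable_id).norm) hφb).div_const 2

/-- **Mean window floor.**  For a probability law whose MEAN HOST on the window is `L` (`E_Q[u n − u 0] = 0`, `n ∈ B`) and whose window increments
are `≤ ρ`: per-bond floors at radius `ρ` + a mean second-order floor `−Θ` give `windowEnergy(host) − Θ ≤ E_Q[windowEnergy]` — the linear terms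
have mean zero. [folklore] -/
theorem le_integral_windowEnergy (Q : Measure (Idx → E3)) [IsProbabilityMeasure Q] (hmean : ∀ n ∈ B, ∫ u, (u n - u 0) ∂Q = 0)
    (hwin : IsWindow B ρ Q) (hcert : ∀ n ∈ B, BondFloor φ (L n) ρ (ℓ n) (q n)) (hφm : Measurable φ) {C : ℝ}
    (hφb : ∀ n ∈ B, ∀ D : E3, ‖D‖ ≤ ρ → |φ ‖L n + D‖| ≤ C) (hqm : ∀ n ∈ B, Measurable (q n)) {Cq : ℝ}
    (hqb : ∀ n ∈ B, ∀ D : E3, ‖D‖ ≤ ρ → |q n D| ≤ Cq) {Θ : ℝ} (hΘ : -Θ ≤ ∫ u, (∑ n ∈ B, q n (u n - u 0)) / 4 ∂Q) :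
    windowEnergy φ L B 0 - Θ ≤ ∫ u, windowEnergy φ L B u ∂Q := by
  have hIℓ : Integrable (fun u : Idx → E3 => ∑ n ∈ B, ℓ n (u n - u 0)) Q :=
    integrable_finsetSum _ fun n hn => (ℓ n).integrable_comp (integrable_eval_sub_eval_zero_of_isWindow hwin hn)
  have hℓ0 : ∫ u, ∑ n ∈ B, ℓ n (u n - u 0) ∂Q = 0 := by  -- linear functionals of mean-zero increments have mean zero
    rw [integral_finsetSum _ fun n hn => (ℓ n).integrable_comp (integrable_eval_sub_eval_zero_of_isWindow hwin hn)]
    refine Finset.sum_eq_zero fun n hn => ?_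
    rw [(ℓ n).integral_comp_comm (integrable_eval_sub_eval_zero_of_isWindow hwin hn), hmean n hn, map_zero]
  have h3 : Integrable (fun u : Idx → E3 => (∑ n ∈ B, ℓ n (u n - u 0)) / 2) Q := hIℓ.div_const 2
  have h1 : Integrable (fun u : Idx → E3 => windowEnergy φ L B 0 + (∑ n ∈ B, ℓ n (u n - u 0)) / 2) Q := (integrable_const _).add h3
  have h2 : Integrable (fun u : Idx → E3 => (∑ n ∈ B, q n (u n - u 0)) / 4) Q := (integrable_finset_sum_of_isWindow hwin hqm hqb).div_const 4
  have hcalc : ∫ u, (windowEnergy φ L B 0 + (∑ n ∈ B, ℓ n (u n - u 0)) / 2 + (∑ n ∈ B, q n (u n - u 0)) / 4) ∂Q =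
      windowEnergy φ L B 0 + ∫ u, (∑ n ∈ B, q n (u n - u 0)) / 4 ∂Q := by
    rw [integral_add h1 h2, integral_add (integrable_const _) h3, integral_const, probReal_univ, one_smul,
      integral_div (2 : ℝ), hℓ0, zero_div, add_zero]
  have hmono : ∫ u, (windowEnergy φ L B 0 + (∑ n ∈ B, ℓ n (u n - u 0)) / 2 + (∑ n ∈ B, q n (u n - u 0)) / 4) ∂Q ≤
      ∫ u, windowEnergy φ L B u ∂Q := by
    refine integral_mono_ae (h1.add h2) (integrable_windowEnergy hwin hφm hφb) ?_
    filter_upwards [hwin] with u hu using windowEnergy_ge_pointwise hcert hu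
  rw [hcalc] at hmono
  linarith

/-! ## §3. The two instances of the bridge: finite range (pointwise) and asymptotic regime (harmonic) -/

/-- A pointwise floor `−Θ ≤ f` almost surely with `0 ≤ Θ` gives `−Θ ≤ E_Q[f]` WITHOUT integrability (the junk value `0` is also `≥ −Θ`). -/
theorem neg_le_integral_of_ae_le [IsProbabilityMeasure Q] {f : (Idx → E3) → ℝ} {Θ : ℝ} (hΘ : 0 ≤ Θ) (h : ∀ᵐ u ∂Q, -Θ ≤ f u) :
    -Θ ≤ ∫ u, f u ∂Q := by
  by_cases hf : Integrable f Q
  · simpa [integral_const, probReal_univ] using integral_mono_ae (integrable_const (-Θ)) hf h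
  · rw [integral_undef hf]; linarith

/-- **FINITE RANGE (the base range of the dial, no phonon analysis).**  If each bond's second-order term dominates a quadratic,
`−λ_n‖D‖² ≤ q_n(D)` on the `ρ`-ball with `λ_n ≥ 0` (for `V_LJ`: `λ_n =` the negative part of the smallest Hessian eigenvalue `min(φ″, φ′/r)` over
the segment; `> 0` only for `r > (13/7)^{1/6} ≈ 1.1087`), then the mean floor holds with `Θ = ¼ρ²·Σ_{n ∈ B} λ_n` (`→ 0` quadratically: every host
with a positive window margin has a window radius `ρ₁(L) > 0` below which the single-grain gap holds). [folklore] -/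
theorem meanSecondOrderFloor_of_pointwise {lam : Idx → ℝ} (hlam : ∀ n ∈ B, 0 ≤ lam n)
    (hq : ∀ n ∈ B, ∀ D : E3, ‖D‖ ≤ ρ → -(lam n * ‖D‖ ^ 2) ≤ q n D) :
    MeanSecondOrderFloor B q ρ (ρ ^ 2 * (∑ n ∈ B, lam n) / 4) := by
  intro Q _ _ hwin
  have hΘ : 0 ≤ ρ ^ 2 * (∑ n ∈ B, lam n) / 4 := by have := Finset.sum_nonneg hlam; positivity
  refine neg_le_integral_of_ae_le hΘ ?_
  filter_upwards [hwin] with u hu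
  have hD : ∀ n ∈ B, -(lam n * ρ ^ 2) ≤ q n (u n - u 0) := fun n hn => by
    have h1 := hq n hn (u n - u 0) (hu n hn)
    have h2 := mul_le_mul_of_nonneg_left (pow_le_pow_left₀ (norm_nonneg _) (hu n hn) 2) (hlam n hn)
    linarith
  have hs : ∑ n ∈ B, -(lam n * ρ ^ 2) ≤ ∑ n ∈ B, q n (u n - u 0) := Finset.sum_le_sum hD
  rw [Finset.sum_neg_distrib, ← Finset.sum_mul] at hs
  linarith

/-- **MEAN HARMONIC STABILITY of the windowed force constants `H_n`** [UNDECIDED per strained host · INSTRUMENTABLE · typed, not proved]: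
`0 ≤ E_Q[Σ_{n ∈ B} ⟨H_n (u n − u 0), u n − u 0⟩]` for every shift-stationary probability law with window increments `≤ ρ`.  By Herglotz/Bochner
this is `∫ tr(D_B(k) dF(k)) ≥ 0` with `D_B(k) = Σ_{n ∈ B} H_n (1 − cos k·n)` the WINDOWED DYNAMICAL MATRIX of the host and `F` the spectral measure
of `u`, so it follows from phonon stability `D_B(k) ⪰ 0 ∀ k` (a trigonometric matrix polynomial: sampling + Lipschitz, or SOS; cf. crux
`PhononStability` stmt-9333 for unstrained hosts); OPEN for the strained all-bad hosts of GOOD49. [Born–Huang lattice dynamics; folklore] -/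
def MeanHarmonicStability (B : Finset Idx) (H : Idx → E3 →L[ℝ] E3) (ρ : ℝ) : Prop :=
  ∀ Q : Measure (Idx → E3), IsProbabilityMeasure Q → IsShiftStationary Q → IsWindow B ρ Q →
    0 ≤ ∫ u, ∑ n ∈ B, inner ℝ (H n (u n - u 0)) (u n - u 0) ∂Q

/-- **ASYMPTOTIC REGIME (the bridge with the quadratic form kept exactly).**  If the second-order terms dominate the harmonic form up to a cubic
slack, `⟨H_n D, D⟩ − κ_n‖D‖³ ≤ q_n(D)` on the `ρ`-ball with `κ_n ≥ 0`, and the windowed force constants are mean-harmonically stable, then the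
mean floor holds with `Θ = ¼ρ³·Σ_{n ∈ B} κ_n` (one order better in `ρ`; but for `V_LJ` at nearest-neighbour compression `κ ≈ sup|φ‴|/3 ≈ 140` per
bond, so it only pays below `ρ ≈ 1/50` — node memo). [folklore] -/
theorem meanSecondOrderFloor_of_harmonic {H : Idx → E3 →L[ℝ] E3} {κ : Idx → ℝ} (hκ : ∀ n ∈ B, 0 ≤ κ n) (hρ : 0 ≤ ρ)
    (hq : ∀ n ∈ B, ∀ D : E3, ‖D‖ ≤ ρ → inner ℝ (H n D) D - κ n * ‖D‖ ^ 3 ≤ q n D)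
    (hH : MeanHarmonicStability B H ρ) : MeanSecondOrderFloor B q ρ (ρ ^ 3 * (∑ n ∈ B, κ n) / 4) := by
  intro Q _ hstat hwin
  have hΘ : 0 ≤ ρ ^ 3 * (∑ n ∈ B, κ n) / 4 := by have := Finset.sum_nonneg hκ; positivity
  have h0 := hH Q ‹_› hstat hwin
  -- the harmonic side is integrable: continuous in the increment, bounded by `‖H_n‖ρ²` on the window ball
  have hIh : Integrable (fun u : Idx → E3 => ∑ n ∈ B, inner ℝ (H n (u n - u 0)) (u n - u 0)) Q := by
    refine integrable_finset_sum_of_isWindow hwin (g := fun n D => inner ℝ (H n D) D)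
      (fun n _ => ((H n).continuous.inner continuous_id).measurable) (C := (∑ n ∈ B, ‖H n‖) * ρ ^ 2) ?_
    intro n hn D hD
    calc |inner ℝ (H n D) D| ≤ ‖H n D‖ * ‖D‖ := abs_real_inner_le_norm _ _
      _ ≤ (‖H n‖ * ‖D‖) * ‖D‖ := by gcongr; exact (H n).le_opNorm _
      _ = ‖H n‖ * ‖D‖ ^ 2 := by ring
      _ ≤ ‖H n‖ * ρ ^ 2 := by gcongr
      _ ≤ (∑ m ∈ B, ‖H m‖) * ρ ^ 2 := by
          gcongr; exact Finset.single_le_sum (f := fun m => ‖H m‖) (fun m _ => norm_nonneg _) hn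
  -- pointwise on the window ball: harmonic form − ρ³Σκ ≤ Σ q
  have hpt : ∀ᵐ u ∂Q, (∑ n ∈ B, inner ℝ (H n (u n - u 0)) (u n - u 0) - ρ ^ 3 * ∑ n ∈ B, κ n) / 4 ≤
      (∑ n ∈ B, q n (u n - u 0)) / 4 := by
    filter_upwards [hwin] with u hu
    have hD : ∀ n ∈ B, inner ℝ (H n (u n - u 0)) (u n - u 0) - κ n * ρ ^ 3 ≤ q n (u n - u 0) := fun n hn => by
      have h1 := hq n hn (u n - u 0) (hu n hn)
      have h2 := mul_le_mul_of_nonneg_left (pow_le_pow_left₀ (norm_nonneg _) (hu n hn) 3) (hκ n hn)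
      linarith
    have hs := Finset.sum_le_sum hD
    rw [Finset.sum_sub_distrib, ← Finset.sum_mul] at hs
    linarith [hs, show (∑ n ∈ B, κ n) * ρ ^ 3 = ρ ^ 3 * ∑ n ∈ B, κ n by ring]
  by_cases hIq : Integrable (fun u : Idx → E3 => (∑ n ∈ B, q n (u n - u 0)) / 4) Q
  · have hI1 : Integrable (fun u : Idx → E3 => (∑ n ∈ B, inner ℝ (H n (u n - u 0)) (u n - u 0) - ρ ^ 3 * ∑ n ∈ B, κ n) / 4) Q :=
      (hIh.sub (integrable_const _)).div_const 4
    have hmono := integral_mono_ae hI1 hIq hpt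
    rw [integral_div, integral_sub hIh (integrable_const _), integral_const, probReal_univ, one_smul] at hmono
    linarith
  · rw [integral_undef hIq]; linarith

end Summit.AtomisticToContinuum.Crystallization.Theorems.FrustratedLawDichotomySingleGrainTube
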